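import Literature.NumberTheory.EllipticCurves.KellerYin2024.AnomalousRankZeroProofs
import Literature.NumberTheory.EllipticCurves.Rank1Residual.Predicates
import Literature.NumberTheory.EllipticCurves.Rank1Residual.PrintShapeTorsion
import Literature.NumberTheory.EllipticCurves.Rank1Residual.X10Proofs
import Literature.NumberTheory.EllipticCurves.NonvanishingTwistsWaldspurgerOfHoffsteinLuo
import Literature.NumberTheory.EllipticCurves.NonvanishingTwistsProofs
import Literature.NumberTheory.EllipticCurves.GrossZagierRationalPoint
import Literature.NumberTheory.EllipticCurves.BSDRootNumberModularityOnlyProofs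
import Literature.NumberTheory.EllipticCurves.AnalyticRankModularityProofs
import Literature.NumberTheory.EllipticCurves.LFunctionSmulProofs
import Literature.NumberTheory.EllipticCurves.CyclotomicIwasawaMainTheoremIrreducibleBaseChangeProofs
import HarnessLib

/-!
# BSD in analytic rank `≤ 1` over `ℚ`, residual class X1 (Eisenstein anomalous, good `p`):
# the Keller–Yin chain assembled from its PUBLISHED links, with the unpublished links as hypotheses

HONEST FRAMING (cell `b2b-bsdres`, home `run/shared/lean/b2b/bsd-rank1-residual/`). The goal is to
DELETE the COMBINATION-SHAPED residual classes for ALL analytic-rank `≤ 1` curves over `ℚ` — "full BSD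
formula for every rank `≤ 1` curve in class C" assembled STRICTLY from published theorems — so that the
rank-`≤ 1` remainder becomes exactly the CONSTRUCTION-SHAPED classes, which are TYPED (missing-input
`Prop`s), NOT attempted; this is not "finishing BSD". This file is the KELLER–YIN-ROUTE companion of
`Rank1Residual/ClassX1.lean` (the Wuthrich/Kato one-sided route): it follows the announced proof of
Keller–Yin, arXiv:2402.12781v2, Thm. 4.2.1 (= Thm. 3; PREPRINT) and shows, kernel-checked, exactly
what its PUBLISHED links give and where the UNPUBLISHED ones enter — each as an explicit hypothesis
named `…_OPEN`. Audit file: `b2b-bsdres-x1a/X1-CHAIN.md` (links L1–L10).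

Class X1 (`Rank1Residual.ClassX1`, RESIDUAL-CASES.md §a.2): `2 < p`, `E[p]` reducible, good
reduction at `p`, `a_p ≡ 1 (mod p)` (anomalous: `{φ|_{G_p}, ψ|_{G_p}} = {1, ω}` — the case
EXCLUDED by Castella–Grossi–Skinner, Math. Ann. 393 (2025), Thms. 1 and 4), and
`¬(r = 0 ∧ gvpar(p))`. Under anomaly the two isogeny-kernel characters of `E[p]^{ss}` are of type
A = {(unramified-at-`p`, even), (ramified, odd)} [`¬ GVPar`, e.g. a rational `p`-torsion point:
`11a1@5`, `14a1@3`, `26b1@7`] or B = {(unramified, odd), (ramified, even)} [`GVPar`]; a twist by an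
imaginary quadratic `K` with `p` split swaps A ↔ B and keeps anomaly.

## What is proved (conclusion always Miller's `BSDp W p`)

* `bsdp_of_classX1_of_analyticRank_eq_zero_of_mazurMC_OPEN` — **X1 ∩ {r = 0}** (type A, as type B
  with `r = 0` is Greenberg–Vatsal's covered class C7): from modularity, Gross–Zagier–Kolyvagin,
  Greenberg's Euler characteristic formula (LNM 1716, Thm. 4.1, hypothesis `hGr`) — all published —
  and ONE hypothesis `hMC_OPEN`: Mazur's main conjecture for `(E, p)` in the Néron normalisation.
  That input is NOT in print at an anomalous prime of type A (Greenberg–Vatsal 2000 Thm. 1.3 needs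
  type B; Castella–Grossi–Skinner 2025 Thm. 1 needs `φ|_{G_p} ≠ 1, ω`) and is NOT STATED by
  Keller–Yin (who prove anticyclotomic main conjectures only; §0.5 asserts the extension in prose,
  as does M. Yin, arXiv:2410.24193, §0.2). Wrapper of
  `KellerYin2024.bsdp_of_mazurMainConjecture_of_analyticRank_eq_zero`.
* `bsdp_of_classX1_of_analyticRank_eq_one_of_KY_OPEN` — **X1 ∩ {r = 1}**: from modularity
  (`exists_isNewformOf`), Hoffstein–Luo's non-vanishing twist (→ an admissible `K`: imaginary
  quadratic, `d_K ≡ 1 (mod 8)` so `d_K < -4` odd, every `ℓ ∣ N` and `p` split, `L(E^K,1) ≠ 0`),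
  Gross–Zagier I.7.3 (rationality of `L'(E,1)/(Ω·Reg)`), Gross–Zagier–Kolyvagin, the existence of a
  global minimal model of the twist — all published tree facts/theorems — and TWO hypotheses:
  `hKY_OPEN` = Keller–Yin's rank-one display (proof of Thm. 4.2.1, p. 22; =
  `KellerYin2024.thm421_rankOne_display_OPEN` of `KellerYin2024/AnomalousBSD.lean`; its unpublished
  links are KY Thm. 3.0.11 (IMC2) and Thm. 7.0.6 (control with torsion), the rest — Gross–Zagier,
  Bertolini–Darmon–Prasanna, Kolyvagin, [CGLS] (5.5)–(5.7) — is published), and `hpartner` = the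
  rank-`0` `p`-part for the twist `E^K` ([CGLS] Thm. 5.1.4): a PUBLISHED consequence of
  Greenberg–Vatsal 2000 Thm. 1.3 + Kato + Greenberg Thm. 4.1 + Mazur–Swinnerton-Dyer (the tree glue
  `padicValRat_bsd_rank_zero_of_mazurMainConjecture`) when `E` is of type A (then `E^K` is of type B
  and satisfies (GV)), and OPEN (Mazur's main conjecture at an anomalous prime of type A, for `E^K`)
  when `E` is of type B. The Galois-module lemma "type A for `E` ⇔ (GV) for `E^K`" (twisting a
  `Γ_ℚ`-stable line by the odd, unramified-at-`p` character `χ_K`) is not formalised here; it is the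
  only reason `hpartner` is kept as a hypothesis on the pair rather than discharged from a
  Greenberg–Vatsal fact.

So, from PUBLISHED inputs: X1 ∩ {r = 1, type A} is closed modulo exactly Keller–Yin Thms. 3.0.11 +
7.0.6 (announced); X1 ∩ {r = 0} and X1 ∩ {r = 1, type B} are closed modulo Mazur's main conjecture
at an anomalous Eisenstein prime of type A — a statement with no theorem number anywhere.

## References
* T. Keller, M. Yin, arXiv:2402.12781v2, Thm. 4.2.1 and its proof (p. 22), Thms. 3.0.11, 7.0.6, §0.5.
* F. Castella, G. Grossi, J. Lee, C. Skinner, Invent. Math. 227 (2022), §5. [CastellaEtAl2021]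
* F. Castella, G. Grossi, C. Skinner, Math. Ann. 393 (2025), Thms. 1, 4. [CastellaGrossiSkinner2025]
* R. Greenberg, V. Vatsal, Invent. Math. 142 (2000), Thm. 1.3; R. Greenberg, LNM 1716, Thm. 4.1.
* J. Hoffstein, W. Luo, Math. Res. Lett. 4 (1997); B. Gross, D. Zagier, Invent. Math. 84 (1986),
  Thm. I.7.3; R. L. Miller, LMS J. Comput. Math. 14 (2011), Def. 1.1.
-/

set_option autoImplicit false

noncomputable section

open scoped Classical MatrixGroups ModularForm

open CongruenceSubgroup WeierstrassCurve Literature.NumberTheory.EllipticCurves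
  Literature.NumberTheory.EllipticCurves.ModularForms

namespace Literature.NumberTheory.EllipticCurves.Rank1Residual

/-! ### Rank 0 -/

/-- **X1 ∩ {r = 0} modulo Mazur's main conjecture at the anomalous prime.** For `W/ℚ` globally
minimal and elliptic and a class-X1 prime `p` (`ClassX1 W p`) with `ord_{s=1} L(E,s) = 0`, Miller's
`BSD(E,p)` follows from modularity with an integral Manin constant (`hmod`), Gross–Zagier–Kolyvagin
(`hGZK`), Greenberg's Euler-characteristic identity LNM 1716 Thm. 4.1 for `(E,p)` (`hGr`, the
spelling of `LeadingTermPPartProofs`; PUBLISHED) and `hMC_OPEN`: Mazur's cyclotomic main conjecture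
for `(E,p)`, Néron normalisation (`char_Λ X(E/ℚ_∞) = (ϖ·L_p(f,α))`, `ϖ·Ω_E = Ω⁺_f`) — NOT IN PRINT
for this class (anomalous, type A) and not stated by Keller–Yin; this is the hypothesis under which
Keller–Yin's Thm. 4.2.1 holds in rank `0` by its own printed argument ([CGS] Thm. 4, r = 0 ⇒ [CGLS]
Thm. 5.1.4 with the main conjecture in place of [GV00]).
[cite: KellerYin2024, Thm. 4.2.1 (p. 22), proof, and §0.5] [cite: CastellaEtAl2021, Thm. 5.1.4] -/
theorem bsdp_of_classX1_of_analyticRank_eq_zero_of_mazurMC_OPEN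
    (W : WeierstrassCurve ℚ) [W.IsElliptic] [W.IsGloballyMinimal] (p : ℕ) [Fact p.Prime]
    (hX1 : ClassX1 W p) (hr : W.analyticRank = 0)
    (hmod : nonempty_modularParametrizationData)
    (hGZK : rank_eq_analyticRank_of_analyticRank_le_one)
    (hGr : ∀ (κ : ZpExtension ℚ p) (γ : Field.absoluteGaloisGroup ℚ),
        κ.IsCyclotomic → κ.IsTopGenerator γ → IsCyclotomicVariable p γ →
      ∀ (D : W.SelmerDualData κ γ) [Module.Finite (IwasawaAlgebra p) D.X], D.IsTorsion →
      ∀ (fE : IwasawaAlgebra p), D.charIdeal = Ideal.span {fE} →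
        Finite (W.selmerGroupPInfty p) →
        ∃ u : ℤ_[p]ˣ,
          ((PowerSeries.constantCoeff fE : ℤ_[p]) : ℚ_[p]) *
              (Nat.card (AddCommGroup.primaryComponent W.toAffine.Point p) : ℚ_[p]) ^ 2 =
            ((u : ℤ_[p]) : ℚ_[p]) * (p : ℚ_[p]) ^ (padicValNat p W.tamagawaProduct) *
              (Nat.card (AddCommGroup.primaryComponent
                ((integralModelInt W).map (Int.castRingHom (ZMod p))).toAffine.Point p) : ℚ_[p]) ^ 2 *
              (Nat.card (W.selmerGroupPInfty p) : ℚ_[p]))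
    (hMC_OPEN : ∀ (κ : ZpExtension ℚ p) (γ : Field.absoluteGaloisGroup ℚ),
        κ.IsCyclotomic → κ.IsTopGenerator γ → IsCyclotomicVariable p γ →
      ∀ [NeZero (W.conductorNorm ℤ)] (f : CuspForm (Gamma0 (W.conductorNorm ℤ)) 2),
        IsNewformOf W f → ∀ (ϖ : ℚ), (ϖ : ℝ) * W.realPeriodRat = plusPeriod f →
      ∀ (D : W.SelmerDualData κ γ), D.IsTorsion ∧
        ∃ g : IwasawaAlgebra p, D.charIdeal = Ideal.span {g} ∧
          iwasawaToPowerSeries p g =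
            PowerSeries.C (ϖ : ℚ_[p]) * padicLFunction f (unitRoot W p : ℚ_[p])) :
    BSDp W p :=
  KellerYin2024.bsdp_of_mazurMainConjecture_of_analyticRank_eq_zero W p hX1.2.2.1 hX1.2.2.2.1.2.2 hr
    hmod hGZK hGr hMC_OPEN

/-! ### Rank 1: the admissible auxiliary field, then the assembly -/

/-- **An admissible auxiliary field** ([CGLS] proof of Thm. 5.3.1, (a)–(d); Keller–Yin §0.1): for
`E/ℚ` with `w(E) = -1` and a prime `p`, there is an imaginary quadratic `K` with `d_K ≡ 1 (mod 8)`
(so `d_K` is odd and `d_K < -4`, whence `u_K = 1`), every prime of `N_E` split, `p` split, and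
`L(E^{(d_K)}, 1) ≠ 0` — from Hoffstein–Luo's non-vanishing theorem with prescribed residue classes
(`hHL`; Math. Res. Lett. 4 (1997)) and the sign computation from modularity (`hmod`), via the tree
theorem `exists_neg_fundamental_twist_ne_zero_of_hoffsteinLuo` and the dictionary
`exists_heegnerField_iff_exists_fundamental` (same argument as
`exists_heegnerField_odd_split_twist_ne_zero_of_hoffsteinLuo`, keeping `d_K ≡ 1 (mod 8)` and
`|d_K| > 4`). [cite: HoffsteinLuo1997, Theorem (§1, pp. 435–436)]
[cite: CastellaEtAl2021, proof of Thm. 5.3.1, conditions (a)–(d)] -/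
theorem exists_admissibleField_of_rootNumber_eq_neg_one (hmod : exists_isNewformOf)
    (hHL : HoffsteinLuo1997_exists_twist_L_one_ne_zero) (W : WeierstrassCurve ℚ) [W.IsElliptic]
    (hw : W.rootNumber = -1) (p : ℕ) [Fact p.Prime] :
    ∃ (K : Type) (_ : Field K) (_ : NumberField K), IsImaginaryQuadratic K ∧
      Odd (NumberField.discr K) ∧ NumberField.discr K < -4 ∧
      SatisfiesHeegnerHypothesis (W.conductorNorm ℤ) K ∧ SatisfiesHeegnerHypothesis p K ∧
        (W.quadraticTwist (NumberField.discr K : ℚ)).entireLFunction 1 ≠ 0 := by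
  have hpP : p.Prime := Fact.out
  obtain ⟨d, hdneg, hsq, hd8, hB, hjacS, hjacN, hL⟩ :=
    exists_neg_fundamental_twist_ne_zero_of_hoffsteinLuo hmod hHL W hw {p} 4
  -- the character conditions at the primes of `N_E · p`
  have hkr : ∀ q : ℕ, q.Prime → q ∣ W.conductorNorm ℤ * p →
      (q = 2 → d % 8 = 1) ∧ (q ≠ 2 → jacobiSym d q = 1) := by
    intro q hq hqNp
    refine ⟨fun _ ↦ hd8, fun hq2 ↦ ?_⟩
    rcases (Nat.Prime.dvd_mul hq).mp hqNp with hqN | hqp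
    · exact hjacN q hq hqN hq2
    · have hqp' : q = p := (Nat.prime_dvd_prime_iff_eq hq hpP).mp hqp
      subst hqp'
      exact hjacS q (Finset.mem_singleton_self q) hq hq2
  -- the field `K = ℚ(√d)`, `d_K = d ≡ 1 (mod 8)`, `|d_K| > 4`
  obtain ⟨K, _, _, hK, hBK, hH, hd8K, hLK⟩ :=
    (exists_heegnerField_iff_exists_fundamental (W.conductorNorm ℤ * p) 4
      (fun D ↦ D % 8 = 1 ∧ (W.quadraticTwist (D : ℚ)).entireLFunction 1 ≠ 0)).mpr
      ⟨d, hdneg, Or.inl ⟨by omega, hsq, by omega⟩, hB, hkr, hd8, hL⟩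
  have hneg : NumberField.discr K < 0 := IsImaginaryQuadratic.discr_neg hK
  refine ⟨K, inferInstance, inferInstance, hK, Int.odd_iff.mpr (by omega), ?_,
    hH.of_dvd (dvd_mul_right _ _), hH.of_dvd (dvd_mul_left _ _), hLK⟩
  have h4 : 4 < (NumberField.discr K).natAbs := hBK
  omega

/-- **X1 ∩ {r = 1} along Keller–Yin's printed proof, with its unpublished links as hypotheses.**
Let `W/ℚ` be globally minimal and elliptic, `p` a class-X1 prime (`ClassX1 W p`), and
`ord_{s=1} L(E,s) = 1`. PUBLISHED inputs (named tree facts): modularity (`hmod : exists_isNewformOf`,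
giving the entire continuation and `w(E) = -1`), Hoffstein–Luo (`hHL`, the admissible `K`),
Gross–Zagier I.7.3 (`hGZ`, `L'(E,1)/(Ω·Reg) ∈ ℚ`), Gross–Zagier–Kolyvagin (`hGZK`); tree theorems:
global minimal model of the twist, isomorphism invariance of `L`. HYPOTHESES: `hKY_OPEN` — the
rank-one display of Keller–Yin's proof of Thm. 4.2.1 (p. 22), universally quantified exactly as the
`Prop` `KellerYin2024.thm421_rankOne_display_OPEN` (so that `Prop` can be passed for it),
whose unpublished links are KY Thm. 3.0.11 (anticyclotomic IMC at an anomalous Eisenstein prime) and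
KY Thm. 7.0.6 (anticyclotomic control with torsion), the other links being Gross–Zagier,
Bertolini–Darmon–Prasanna, Kolyvagin and [CGLS] (5.5)–(5.7) (published); and `hpartner` — the
rank-`0` `p`-part (`PPartRankZero`) of every globally minimal model of the admissible twist `E^K`
with `ord_{s=1} L(E^K,s) = 0`, i.e. [CGLS] Thm. 5.1.4 for `E^K`: PUBLISHED (Greenberg–Vatsal 2000
Thm. 1.3 + Kato + Greenberg Thm. 4.1 + Mazur–Swinnerton-Dyer, the tree's
`padicValRat_bsd_rank_zero_of_mazurMainConjecture`) when `E` is of type A = `¬ GVPar W p` (then `E^K`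
satisfies (GV)), OPEN when `E` is of type B (`E^K` anomalous of type A). Conclusion: Miller's
`BSD(E,p)`. Proof: `K` by `exists_admissibleField_of_rootNumber_eq_neg_one`; `Wd` a global minimal
model of `E^{(d_K)}`; `q = L'(E,1)/(Ω Reg)` by Gross–Zagier, `qd = L(E^K,1)/Ω_{E^K}` with its
valuation by `hpartner`; the display gives `ord_p q = ord_p #Ш + ord_p ∏c_ℓ - 2 ord_p #E(ℚ)_tors`,
i.e. `PPart W p`, and `bsdp_of_pPart` concludes.
[cite: KellerYin2024, Thm. 4.2.1 and its proof (p. 22)] [cite: CastellaEtAl2021, Thm. 5.3.1 and its proof, Thm. 5.1.4] -/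
theorem bsdp_of_classX1_of_analyticRank_eq_one_of_KY_OPEN
    (W : WeierstrassCurve ℚ) [W.IsElliptic] [W.IsGloballyMinimal] (p : ℕ) [Fact p.Prime]
    (hX1 : ClassX1 W p) (hr : W.analyticRank = 1)
    (hmod : exists_isNewformOf) (hHL : HoffsteinLuo1997_exists_twist_L_one_ne_zero)
    (hGZ : GrossZagier1986_thm_I_7_3) (hGZK : rank_eq_analyticRank_of_analyticRank_le_one)
    (hKY_OPEN : ∀ (W' : WeierstrassCurve ℚ) [W'.IsElliptic] [W'.IsGloballyMinimal] (p' : ℕ)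
        [Fact p'.Prime], p' ≠ 2 → W'.HasGoodReductionAtPrime p' → ¬ W'.HasIrreducibleModPGaloisRep p' →
        W'.analyticRank = 1 →
      ∀ (K : Type) [Field K] [NumberField K], IsImaginaryQuadratic K →
        Odd (NumberField.discr K) → NumberField.discr K < -4 →
        SatisfiesHeegnerHypothesis (W'.conductorNorm ℤ) K → SatisfiesHeegnerHypothesis p' K →
        (W'.quadraticTwist (NumberField.discr K : ℚ)).entireLFunction 1 ≠ 0 →
      ∀ (Wd : WeierstrassCurve ℚ) [Wd.IsElliptic] [Wd.IsGloballyMinimal],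
        (∃ C : VariableChange ℚ, C • Wd = W'.quadraticTwist (NumberField.discr K : ℚ)) →
      ∀ (q qd : ℚ), W'.leadingLCoeff / ((W'.realPeriodRat * W'.regulator : ℝ) : ℂ) = (q : ℂ) →
        Wd.entireLFunction 1 / (Wd.realPeriodRat : ℂ) = (qd : ℂ) →
        padicValRat p' q - ((padicValNat p' W'.shaOrder : ℤ) + padicValNat p' W'.tamagawaProduct -
            2 * padicValNat p' W'.torsionOrder) =
          -(padicValRat p' qd - ((padicValNat p' Wd.shaOrder : ℤ) + padicValNat p' Wd.tamagawaProduct -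
            2 * padicValNat p' Wd.torsionOrder)))
    (hpartner : ∀ (K : Type) [Field K] [NumberField K], IsImaginaryQuadratic K →
        Odd (NumberField.discr K) → NumberField.discr K < -4 →
        SatisfiesHeegnerHypothesis (W.conductorNorm ℤ) K → SatisfiesHeegnerHypothesis p K →
        (W.quadraticTwist (NumberField.discr K : ℚ)).entireLFunction 1 ≠ 0 →
      ∀ (Wd : WeierstrassCurve ℚ) [Wd.IsElliptic] [Wd.IsGloballyMinimal],
        (∃ C : VariableChange ℚ, C • Wd = W.quadraticTwist (NumberField.discr K : ℚ)) →
        Wd.analyticRank = 0 → PPartRankZero Wd p) :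
    BSDp W p := by
  -- the class: `p ≠ 2`, good reduction, `E[p]` reducible (anomaly is not used by the deduction)
  have hp2 : p ≠ 2 := by have := hX1.1; omega
  have hgood : W.HasGoodReductionAtPrime p := hX1.2.2.1
  have hred : ¬ W.HasIrreducibleModPGaloisRep p := hX1.2.1
  -- `w(E) = -1` from `ord_{s=1} L(E,s) = 1` (functional equation sign, from modularity)
  have hw : W.rootNumber = -1 := by
    have h := even_analyticRank_iff_rootNumber_eq_one.rootNumber_eq_neg_one_pow (W := W)
      (even_analyticRank_iff_rootNumber_eq_one_of_exists_isNewformOf W hmod)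
    rw [hr, pow_one] at h
    exact h
  -- the admissible auxiliary field `K` and a global minimal model `Wd` of `E^{(d_K)}`
  obtain ⟨K, _, _, hK, hodd, hlt, hHN, hHp, hLK⟩ :=
    exists_admissibleField_of_rootNumber_eq_neg_one hmod hHL W hw p
  have hd0 : (NumberField.discr K : ℚ) ≠ 0 := by exact_mod_cast (show NumberField.discr K ≠ 0 by omega)
  obtain ⟨Wd, _, _, C, hC⟩ := exists_isGloballyMinimal_smul_eq_quadraticTwist W hd0
  -- the twist has analytic rank `0`
  have hLd : Wd.entireLFunction 1 ≠ 0 := by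
    rw [← Wd.entireLFunction_smul C, hC]
    exact hLK
  have hrd : Wd.analyticRank = 0 := analyticRank_eq_zero_of_entireLFunction_one_ne_zero hLd
  -- `q = L'(E,1)/(Ω·Reg) ∈ ℚ` (Gross–Zagier), `rank E(ℚ) = 1` (Kolyvagin)
  obtain ⟨hrank, hfin⟩ := hGZK W (by omega)
  have hrk : W.mordellWeilRank = 1 := by omega
  obtain ⟨q, hq0, hqL⟩ := leadingLCoeff_eq_rat_mul_of_analyticRank_eq_one (W := W) hGZ hr hrk
  have hΩ : (0 : ℝ) < W.realPeriodRat := W.realPeriodRat_pos_holds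
  have hR : (0 : ℝ) < W.regulator := W.regulator_pos'
  have hΩR : ((W.realPeriodRat * W.regulator : ℝ) : ℂ) ≠ 0 := by
    exact_mod_cast (mul_pos hΩ hR).ne'
  have hq : W.leadingLCoeff / ((W.realPeriodRat * W.regulator : ℝ) : ℂ) = (q : ℂ) := by
    rw [div_eq_iff hΩR, hqL]
    push_cast
    ring
  -- `qd = L(E^K,1)/Ω_{E^K}` with its valuation ([CGLS] Thm. 5.1.4 for the twist)
  obtain ⟨qd, hqd, hvd⟩ := hpartner K hK hodd hlt hHN hHp hLK Wd ⟨C, hC⟩ hrd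
  -- Keller–Yin's display
  have hdisp := hKY_OPEN W p hp2 hgood hred hr K hK hodd hlt hHN hHp hLK Wd ⟨C, hC⟩ q qd hq hqd
  have hv : padicValRat p q = (padicValNat p W.shaOrder : ℤ) + padicValNat p W.tamagawaProduct -
      2 * padicValNat p W.torsionOrder := by
    rw [hvd] at hdisp
    linarith
  -- the print shape, then Miller's `BSD(E,p)`
  exact bsdp_of_pPart W p (WeierstrassCurve.hasEntireLFunction_rat_of_exists_isNewformOf hmod) hGZK
    (by omega) ⟨q, hq, hv⟩

end Literature.NumberTheory.EllipticCurves.Rank1Residual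

end
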